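import Summits.ValiantsHypothesis.ValiantsHypothesis.Theses.FeketeSOS
import Summits.ValiantsHypothesis.ValiantsHypothesis.Theorems.SOSMagnification.Negative.FeketeHardDeltaRange
import Literature.Computability.AlgebraicComplexity.ValiantClasses
import Literature.Computability.AlgebraicComplexity.ArithCircuitProofs
import Literature.Computability.AlgebraicComplexity.IMMInVPProofs
import Literature.Computability.AlgebraicComplexity.SOSDecompositionProofs
import Literature.Computability.AlgebraicComplexity.RealTauConjectureDepthFour
import Literature.Computability.AlgebraicComplexity.BooleanGadgets
import Literature.NumberTheory.GaussSums.GaussJacobiPrime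

/-!
# Line `gauss-sum-formula-witness` for crux `FeketeSOS.SOSMagnification` (stmt-ValiantsHypothesis-3995)

Skeleton (crux-plan, planner-cruxplan-stmt-ValiantsHypothesis-3995-gauss-sum-formula-wi-0, round 1,
2026-08-16) of crux idea card `Cruxes/SOSMagnification/Ideas/gauss-sum-formula-witness.md` (ideator 2;
triage r1: pass ×3, merge-family "character-sum VNP witness" with `gauss-phase-definability` /
`additive-character-vnp-witness`), with the triage sharpenings built in (`1 ≤ n →` guards on every
prime-size hypothesis; `p ≠ 2`; fixed radix `k`; the transfer count stated with `∃ c`, not DST's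
internal `8`).

THE CRUX (route `FeketeSOS`, rank 2): `SOSMagnification := FeketeSOSHard → ValiantsHypothesis`
(`VP_ℂ ≠ VNP_ℂ`), literally (`Disproof.sosMagnification_iff`).  `FeketeSOSHard` = X: `∃ δ > 0 ∃ p₀ ∀ primes
p ≥ p₀`, every `F_p = Σ_{i<s} c_i g_i²` over `ℂ` with `s ≤ p^δ`, `deg g_i ≤ p²` has `Σ_i |supp g_i| ≥ p^{1/2+δ}`,
`F_p = Σ_{m<p} (m|p) X^m` the Fekete polynomial.

THE LINE = Dutta–Saxena–Thierauf magnification for the base-`k` one-hot DIGIT LIFT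
`Fek_{k,p,n}(y) = Σ_{m<p} (m|p) Π_{j<n} y_{j, digit_j(m)}` (`fekDigit`), cut at the family into its two
halves (`valiantsHypothesis_of_vnp_of_notVP`, PROVED), with the VNP half realised by THIS idea's lever —
Gauss-sum inversion gives an explicit FORMULA witness, no Boolean circuits.  The card's three identities are
PROVED here (kernel-closed), so the registered stubs carry only the formula bookkeeping and DST's transfer:

* (V) `Fek ∈ VNP_ℂ` for every radix `k ≥ 2` and odd primes `p_n ≤ kⁿ` (`FekDigitVNP`; PROVED from the witness
  statement `BoolSumWitness` by p-boundedness bookkeeping, `fekDigitVNP_of_boolSumWitness`):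
  - `gaussInversion` (V1, PROVED — the LEVER): `G_p ≠ 0` and `Σ_{x ∈ ℤ/p} e(m x²/p) = (m|p)·G_p + p·[p ∣ m]`;
  - `phaseProduct` (V2, PROVED): at a Boolean point the `r²`-factor product formula
    `Π_{a,b<r} (1 + (e(c 2^{a+b}/p) − 1) E_a E_b)` is the constant `e(c·v²/p)`, `v = Nat.ofBits e`;
  - `stub_psiLiftFormula` (V3a, M): the digit lift `LΨ = Σ_{m<p} Π_j y_{j,digit_j m}` of `Ψ_p = Σ_{m<p} X^m`
    has complexity `≤ c(kn+1)^c` (digit-prefix comparison formula against the constant `p`);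
  - `stub_boolSumWitness` (V3b, L — load-bearing for the idea): GIVEN V1, V2, V3a, an explicit `g ∈ ℂ[y, E]`
    with `boolSum g = Fek_{k,p,n}` and `r`, complexity, degree `≤ c(kn+1)^c`
    (the card's `g = C G⁻¹·[E<p]·LΨ((W_{j,i}(E)·y_{j,i})) − C(p/G)·mon(0)·Π_a(1−E_a)`).
* (T) `X ⇒ Fek ∉ VP_ℂ` for `k ≥ k₀(δ)` and Bertrand primes `kⁿ/2 < p_n ≤ kⁿ` (`FekDigitNotVP`; this half is
  SHARED with the sibling lines `family-cut-transfer-lemma` / `setmultilinear-cut-injective-kronecker` /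
  `sml-polarised-transport` — the lead takes whichever transfer count lands first):
  - `kronFaithful` (T0, PROVED): `ψ^{lin}(Fek_{k,p,n}) = F_p` for `p ≤ kⁿ` (`y_{j,i} ↦ X^{i k^j}`, base-`k` digits);
  - `stub_univariateSOSTransfer` (T1, L): DST24 Lemma 3.1 (PROVED in tree, `∃ c` form) pushed through `ψ^{lin}`:
    `Σ aᵢ gᵢ² = ψ^{lin}(P)` with `s' ≤ (sn+2)^{c(log n+1)}` squares of degree `≤ ⌈n/2⌉(k−1)k^{n−1}` and
    sparsity `≤ C(kn+⌈n/2⌉, ⌈n/2⌉)` for every size-`s`, degree-`≤ n` digit polynomial `P`;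
  - `stub_countingInequalities` (T2, M/L, pure real analysis; VERBATIM the sibling line
    `gauss-phase-definability`'s `CountingEndgame`, so one proof serves both): for `δ ∈ (0,1/2]`, `c`, a radix
    threshold `k₀` past which, for every exponent `a` and large `n`, every `p ∈ (kⁿ/2, kⁿ]` satisfies
    `((nᵃ+a)n+2)^{c(log n+1)} ≤ p^δ`, `⌈n/2⌉(k−1)k^{n−1} ≤ p²`, `((nᵃ+a)n+2)^{c(log n+1)}·C(kn+⌈n/2⌉,⌈n/2⌉) < p^{1/2+δ}`;
  - `fekDigitNotVP_of` (PROVED plumbing): T1 + T0 + T2 + X ⇒ `FekDigitNotVP` (WLOG `δ ≤ 1/2` by the landed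
    `Negative.exists_delta_le_half_of_feketeSOSHard`; X instantiated at the Bertrand prime `p_n ≥ n ≥ p₀`).
* `SOSMagnification_of : FeketeSOS.SOSMagnification` composes the four stubs and the proved parts into the
  crux BY NAME (no hypotheses, no `sorry` of its own; the `VP = VNP ⇒ ⊥` step with a Bertrand selector of
  odd primes is adapted from ideator 3's checked `SketchIdeator3.SOSMagnification_of`).  HARDEST stub:
  `stub_boolSumWitness` (the idea's load-bearing formula bookkeeping); `stub_univariateSOSTransfer` is of the
  same size; `stub_countingInequalities` and `stub_psiLiftFormula` are M-sized.

Vocabulary (`digit`, `fekDigit`, `kron`, `feketePoly`) is copied VERBATIM from `Cruxes/SOSMagnification/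
SketchIdeator3.lean` so that all r1 lines of this crux share one family; `feketePoly p` unfolds verbatim to
the right-hand side inlined in the route items.

## Disproof used (cdisprove v1.2, `Cruxes/SOSMagnification/Disproof.lean`; landed
`Theorems/SOSMagnification/Negative/FeketeHardDeltaRange.lean`, p73035, imported below)
* `not_sosMagnification_iff` (immunity: ¬crux ↔ X ∧ ¬VH) — the line is a PROOF line; no stub asserts X or ¬VH.
* There is NO `_false_without_<H>` theorem for this crux (nothing to honour by construction); the only
  load-bearing hypothesis of the crux is X itself, consumed verbatim and only in the PROVED plumbing
  `fekDigitNotVP_of` (no stub mentions X: the stubs are unconditional statements).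
* `feketeSOSHard_iff_small` / landed `exists_delta_le_half_of_feketeSOSHard` (WLOG `δ ≤ 1/2`) — USED in
  the proved plumbing `fekDigitNotVP_of` (so `stub_countingInequalities` may assume `δ ≤ 1/2`); finding 5/5b
  (restricted hypothesis suffices; onset `n₀ ≈ 1.3k–3.3k`) is exactly `stub_countingInequalities`; finding 5c
  (typing slack `s' ≤` quasi-polylog, `deg ≤ p log p`) is respected by `stub_univariateSOSTransfer`'s bounds.
* Refuted strengthenings `not_hardAt_of_half_lt`, `not_hardAt_of_one_lt` concern X(δ) for δ > 1/2: no stub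
  is an instance (no stub asserts any X(δ)).  Negatives index (4 VH entries: UlrichPadded, Elusive,
  GrenetRigidity ×2): disjoint from every stub.
-/

noncomputable section

open MvPolynomial Finset
open scoped BigOperators
open Literature.Computability.AlgebraicComplexity
open Literature.Computability.AlgebraicComplexity.ArithCircuit
open Summit.ValiantsHypothesis.ValiantsHypothesis.Theses

set_option linter.unusedVariables false
set_option linter.dupNamespace false

namespace Summit.ValiantsHypothesis.ValiantsHypothesis.Cruxes.SOSMagnification.GaussSumFormulaWitness

/-! ## Vocabulary (shared with `SketchIdeator3.lean`; travels with the line into `Theorems/`) -/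

/-- The `j`-th base-`k` digit of `m`, as an element of `Fin k`. -/
def digit (k : ℕ) [NeZero k] (m j : ℕ) : Fin k :=
  ⟨(m / k ^ j) % k, Nat.mod_lt _ (Nat.pos_of_neZero k)⟩

/-- DST's one-hot base-`k` digit lift of the Fekete polynomial (the inverse multilinear Kronecker image
`φ^{lin}_{k,n}(F_p)`): `Fek_{k,p,n}(y) = Σ_{m<p} (m|p) · Π_{j<n} y_{j, digit_j(m)}` in the `k·n` variables
`y_{j,i}`, `(j,i) ∈ Fin n × Fin k` (set-multilinear in the digit blocks `j`, degree `n`). -/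
def fekDigit (k : ℕ) [NeZero k] (p : ℕ) [Fact p.Prime] (n : ℕ) : MvPolynomial (Fin n × Fin k) ℂ :=
  ∑ m ∈ range p, C ((legendreSym p m : ℤ) : ℂ) * ∏ j : Fin n, X (j, digit k m j)

/-- The digit lift of `Ψ_p = 1 + X + ⋯ + X^{p−1}`: `LΨ_{k,p,n}(y) = Σ_{m<p} Π_{j<n} y_{j, digit_j(m)}` — the
`(m|p)`-free skeleton of `fekDigit`, a small FORMULA by digit-prefix comparison against `p` (`stub_psiLiftFormula`). -/
def psiLift (k : ℕ) [NeZero k] (n p : ℕ) : MvPolynomial (Fin n × Fin k) ℂ :=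
  ∑ m ∈ range p, ∏ j : Fin n, X (j, digit k m j)

/-- The multilinear Kronecker substitution `ψ^{lin}_{k,n} : y_{j,i} ↦ X^{i·k^j}`. -/
def kron (k n : ℕ) : Fin n × Fin k → Polynomial ℂ :=
  fun v => (Polynomial.X : Polynomial ℂ) ^ ((v.2 : ℕ) * k ^ (v.1 : ℕ))

/-- The Fekete polynomial `F_p = Σ_{m<p} (m|p) X^m ∈ ℂ[X]`, VERBATIM the right-hand side inlined in the
route items `SOSMagnification` / `FeketeSOSHard`. -/
def feketePoly (p : ℕ) [Fact p.Prime] : Polynomial ℂ :=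
  ∑ m ∈ range p, Polynomial.C ((legendreSym p m : ℤ) : ℂ) * Polynomial.X ^ m

/-- The quadratic Gauss sum `G_p = Σ_{x ∈ ℤ/p} e(x²/p)` (`e(t) = exp(2πit)`, Mathlib `ZMod.stdAddChar`). -/
def qGauss (p : ℕ) [NeZero p] : ℂ :=
  ∑ x : ZMod p, (ZMod.stdAddChar (x ^ 2) : ℂ)

/-- The bit-phase gadget `W_c(E) = Π_{a,b<r} (1 + (e(c·2^{a+b}/p) − 1)·E_a·E_b)` on the Boolean variables
`E_a = X (inr a)` of `ℂ[τ ⊕ Fin r]`: a product FORMULA with `r²` affine-bilinear factors whose value at a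
Boolean point `e` is the root of unity `e(c·v(e)²/p)`, `v(e) = Σ_a e_a 2^a` (`phaseProduct`, PROVED). -/
def phasePoly (τ : Type) (p : ℕ) [NeZero p] (c : ZMod p) (r : ℕ) : MvPolynomial (τ ⊕ Fin r) ℂ :=
  ∏ a : Fin r, ∏ b : Fin r,
    (1 + C ((ZMod.stdAddChar (c * 2 ^ ((a : ℕ) + (b : ℕ))) : ℂ) - 1) * X (Sum.inr a) * X (Sum.inr b))

/-! ## The statements of the line (named `Prop`s) -/

/-- **V1 — Gauss inversion of the Legendre symbol.**  For an odd prime `p`: `G_p ≠ 0` and, for every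
`m : ℕ`, `Σ_{x ∈ ℤ/p} e(m x²/p) = (m|p)·G_p + p·[p ∣ m]`. -/
def GaussInversion : Prop :=
  ∀ (p : ℕ) [Fact p.Prime], p ≠ 2 →
    qGauss p ≠ 0 ∧
    ∀ m : ℕ, (∑ x : ZMod p, (ZMod.stdAddChar ((m : ZMod p) * x ^ 2) : ℂ)) =
      ((legendreSym p m : ℤ) : ℂ) * qGauss p + if p ∣ m then (p : ℂ) else 0

/-- **V2 — the bit-phase product formula.**  Under the Boolean substitution of `boolSum`
(`E_a ↦ [e a]`, `y ↦ y`), `W_c(E)` becomes the constant `e(c·v(e)²/p)`, `v(e) = Nat.ofBits e`. -/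
def PhaseProduct : Prop :=
  ∀ (p : ℕ) [NeZero p] (c : ZMod p) (τ : Type) (r : ℕ) (e : Fin r → Bool),
    MvPolynomial.aeval (Sum.elim MvPolynomial.X (fun a => if e a then (1 : MvPolynomial τ ℂ) else 0))
        (phasePoly τ p c r) =
      C ((ZMod.stdAddChar (c * ((Nat.ofBits e : ℕ) : ZMod p) ^ 2)) : ℂ)

/-- **V3a — the digit lift of `Ψ_p` is a small formula** (uniform polynomial complexity bound in `kn`,
for every `p ≤ kⁿ`). -/
def PsiLiftFormula : Prop :=
  ∃ c : ℕ, ∀ (k : ℕ) [NeZero k] (n p : ℕ), 2 ≤ k → p ≤ k ^ n →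
    complexity (psiLift k n p) ≤ c * (k * n + 1) ^ c

/-- **V3 — the explicit Boolean-sum (formula) witness of the digit lift**, with uniform polynomial bounds
in `kn` on the number of Boolean variables, the complexity and the degree. -/
def BoolSumWitness : Prop :=
  ∃ c : ℕ, ∀ (k : ℕ) [NeZero k] (p : ℕ) [Fact p.Prime] (n : ℕ), 2 ≤ k → p ≠ 2 → p ≤ k ^ n →
    ∃ (r : ℕ) (g : MvPolynomial ((Fin n × Fin k) ⊕ Fin r) ℂ),
      boolSum g = fekDigit k p n ∧ r ≤ c * (k * n + 1) ^ c ∧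
      complexity g ≤ c * (k * n + 1) ^ c ∧ g.totalDegree ≤ c * (k * n + 1) ^ c

/-- **V — the digit lift is p-definable** for every radix `k ≥ 2` and every selector of odd primes
`p_n ≤ kⁿ` (`n ≥ 1`).  (Bürgisser Def. 2.5 literally: `IsVNPFamily` = Boolean sum of a `VP` family; the
constants `e(·/p_n)`, `G⁻¹`, `p_n` are free over `ℂ`.)  PROVED below from `BoolSumWitness`. -/
def FekDigitVNP : Prop :=
  ∀ (k : ℕ) [NeZero k], 2 ≤ k → ∀ (pSel : ℕ → ℕ) [∀ n, Fact (pSel n).Prime], (∀ n, pSel n ≠ 2) →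
    (∀ n, 1 ≤ n → pSel n ≤ k ^ n) →
    IsVNPFamily (k := ℂ) (σ := fun n => Fin n × Fin k) (fun n => fekDigit k (pSel n) n)

/-- **T0 — faithfulness of the lift**: `ψ^{lin}_{k,n}(Fek_{k,p,n}) = F_p` as soon as `p ≤ kⁿ` (base-`k`
digits do not wrap: `Σ_j digit_j(m) k^j = m` for `m < kⁿ`). -/
def KronFaithful : Prop :=
  ∀ (k : ℕ) [NeZero k] (p : ℕ) [Fact p.Prime] (n : ℕ), 2 ≤ k → p ≤ k ^ n →
    MvPolynomial.aeval (kron k n) (fekDigit k p n) = feketePoly p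

/-- **T1 — univariate SOS from a digit circuit** (DST24 Lemma 3.1 ∘ `ψ^{lin}`, Remark 2 and eq. (8)):
unconditional, prime-free, `δ`-free. -/
def UnivariateSOSTransfer : Prop :=
  ∃ c : ℕ, ∀ (k n s : ℕ), 2 ≤ k → 1 ≤ n → ∀ P : MvPolynomial (Fin n × Fin k) ℂ,
    complexity P ≤ s → P.totalDegree ≤ n →
    ∃ (s' : ℕ) (a : Fin s' → ℂ) (g : Fin s' → Polynomial ℂ),
      s' ≤ (s * n + 2) ^ (c * (Nat.log 2 n + 1)) ∧
      (∀ i, (g i).natDegree ≤ ((n + 1) / 2) * (k - 1) * k ^ (n - 1)) ∧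
      (∀ i, (g i).support.card ≤ (k * n + (n + 1) / 2).choose ((n + 1) / 2)) ∧
      (∑ i, Polynomial.C (a i) * g i ^ 2) = MvPolynomial.aeval (kron k n) P

/-- **T2 — the counting inequalities (pure real asymptotics; DST24 Claim 3.4 / Thm 3.2 bookkeeping, Disproof
finding 5b).**  For `δ ∈ (0, 1/2]` and any Lemma-3.1 constant `c` there is a radix threshold `k₀` (any `k₀`
with `δ·ln k₀ > ½(1 + ln(2 + 1/k₀))` works, e.g. `k₀ > e^{1.05/δ}`) such that for every `k ≥ k₀` and every
complexity exponent `a`, for all large `n` and every `p ∈ (kⁿ/2, kⁿ]`: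
(i) `((nᵃ+a)n+2)^{c(⌊log₂n⌋+1)} ≤ p^δ`, (ii) `⌈n/2⌉(k−1)k^{n−1} ≤ p²`,
(iii) `((nᵃ+a)n+2)^{c(⌊log₂n⌋+1)} · C(kn+⌈n/2⌉, ⌈n/2⌉) < p^{1/2+δ}`.
VERBATIM the statement `CountingEndgame` of the sibling line `gauss-phase-definability` (one proof serves both). -/
def CountingInequalities : Prop :=
  ∀ (δ : ℝ), 0 < δ → δ ≤ 1 / 2 → ∀ c : ℕ, ∃ k₀ : ℕ, ∀ k : ℕ, k₀ ≤ k → ∀ a : ℕ, ∃ n₀ : ℕ,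
    ∀ n : ℕ, n₀ ≤ n → ∀ p : ℕ, k ^ n < 2 * p → p ≤ k ^ n →
      ((((n ^ a + a) * n + 2) ^ (c * (Nat.log 2 n + 1)) : ℕ) : ℝ) ≤ (p : ℝ) ^ δ ∧
      ((n + 1) / 2) * (k - 1) * k ^ (n - 1) ≤ p ^ 2 ∧
      ((((n ^ a + a) * n + 2) ^ (c * (Nat.log 2 n + 1)) *
          (k * n + (n + 1) / 2).choose ((n + 1) / 2) : ℕ) : ℝ) < (p : ℝ) ^ (1 / 2 + δ)

/-- **T — the VP lower bound for the digit family** delivered by X: for `k ≥ k₀` and every prime selector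
with `kⁿ/2 < p_n ≤ kⁿ` (`n ≥ 1`), the digit lift is NOT p-computable. -/
def FekDigitNotVP : Prop :=
  ∃ k₀ : ℕ, ∀ (k : ℕ) [NeZero k], k₀ ≤ k → ∀ (pSel : ℕ → ℕ) [∀ n, Fact (pSel n).Prime],
    (∀ n, 1 ≤ n → pSel n ≤ k ^ n) → (∀ n, 1 ≤ n → k ^ n < 2 * pSel n) →
    ¬ IsVPFamily (k := ℂ) (σ := fun n => Fin n × Fin k) (fun n => fekDigit k (pSel n) n)

/-! ## The four registered stubs (`sorry` lives only here) -/

/-- **Stub V3a — the digit lift of `Ψ_p` is a small formula (M).**  A uniform `c` with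
`complexity (LΨ_{k,p,n}) ≤ c(kn+1)^c` for all `k ≥ 2`, `p ≤ kⁿ`.
Why true (digit-prefix / lexicographic comparison against the constant `p`): if `p = kⁿ` then
`LΨ = Π_{j<n} (Σ_{i<k} y_{j,i})`; if `p < kⁿ` with base-`k` digits `p = Σ_j p_j k^j`, then `m < p` iff at the
most significant position `t` where the digits differ `m_t < p_t` (and `m_j = p_j` for `j > t`), so
`LΨ = Σ_{t<n} [Π_{j>t} y_{j,p_j}] · [Σ_{i<p_t} y_{t,i}] · Π_{j<t} (Σ_{i<k} y_{j,i})` — a formula with `O(n²k)`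
gates (`complexity_finset_sum_le`, `complexity_finset_prod_le`, `complexity_X_holds`; `O(nk)` with suffix
sharing, not needed).  The set identity `{m < p} = ⊔_t {m : m_j = p_j (j>t), m_t < p_t, m_j free (j<t)}`
is `Nat.lt` in base `k` read lexicographically from the top digit (cf. `Nat.digits_lt_iff`-style lemmas,
or induction on `n` splitting `m = m' + m_{n−1} k^{n−1}`); as polynomials the blocks are the disjoint
pieces of the sum, each block's sum of monomials factorising as displayed (`Finset.prod_sum` /
`Finset.sum_product`-type rearrangements, digits of `m' + i·k^{n−1}` via `Nat.add_mul_div_right`,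
`Nat.add_mul_mod_self_right`).  Size M (the combinatorics of the block decomposition is the work; the
complexity count is routine).  This is the "VP by digit prefixes" remark of the card, isolated so that it can
be proved in parallel with V3b. -/
theorem stub_psiLiftFormula :
    ∃ c : ℕ, ∀ (k : ℕ) [NeZero k] (n p : ℕ), 2 ≤ k → p ≤ k ^ n →
      complexity (psiLift k n p) ≤ c * (k * n + 1) ^ c := by
  sorry

/-- **Stub V3b — the formula witness (L; load-bearing stub of THIS idea).**  GIVEN V1, V2 and V3a: a uniform
`c` such that for all `k ≥ 2`, odd primes `p ≤ kⁿ`: some `g ∈ ℂ[(Fin n × Fin k) ⊕ Fin r]` has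
`boolSum g = Fek_{k,p,n}`, `r ≤ c(kn+1)^c`, `complexity g ≤ c(kn+1)^c`, `deg g ≤ c(kn+1)^c`.
Construction (card): `r := k·n` bits (`2^r ≥ kⁿ ≥ p`), `e := ZMod.stdAddChar`, `G := qGauss p`,
`z_{j,i} := phasePoly(c = i·k^j)·y_{j,i}`,
`g := C G⁻¹ · LT_p(E) · LΨ_p(z) − C (p/G) · (Π_j y_{j,0}) · Π_a (1 − E_a)`, where
`LΨ_p(z) = aeval z (psiLift k n p) = Σ_{m<p} Π_j z_{j,digit_j m}` (`map_sum`, `map_prod`, `aeval_X`) has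
`complexity ≤ complexity (psiLift) + Σ_{j,i} complexity z_{j,i} ≤ c'(kn+1)^{c'} + nk(4r²+r+1)` by V3a and
`complexity_aeval_le` (each `z` charged ONCE; `phasePoly` is `r²` factors of `≤ 3` gates), and
`LT_p(E) = [Nat.ofBits E < p]` is the comparator against the constant `p` with binary digits `p_a`:
`Σ_{a : p_a = 1} (1−E_a)·Π_{b>a} (E_b if p_b = 1 else 1−E_b)`, size `O(r²)`, value `∈ {0,1}` at Boolean points
(cf. `BoolGadgets.allZeroFrom/jleInd` and their `eval_*`/`complexity_*` lemmas for the pattern).  Correctness at a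
Boolean point `e` with `v = Nat.ofBits e`:
`Π_j z_{j,digit_j m} ↦ e(v²·Σ_j digit_j(m) k^j)·mon(m) = e(v² m)·mon(m)` (V2 + digits of `m < p ≤ kⁿ`), so
`boolSum g = G⁻¹ Σ_{m<p} (Σ_{v<p} e(m v²)) mon(m) − (p/G)·mon(0) = Σ_{m<p} (m|p) mon(m)` by V1 (the bijection
`{e : v(e) < p} → ZMod p`, `BoolGadgets.ofBits_injective`, `sum_boolVec_eq_sum_range`).  Bounds:
`complexity ≤ c'(kn+1)^{c'} + O(nk·r²)`, `deg ≤ r + n(2r²+1)` (expanded form of `LΨ(z)`), constants free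
(`complexity_C_holds`), `complexity_finset_sum_le/prod_le`, `totalDegree_finsetSum/Prod`; `c = max c' 6` is ample.  FULL witness checked
coefficientwise for `(n,k,p) ∈ {(2,3,7),(2,4,13),(3,2,7)}` (triage r1-3 E2) and `{(2,3,7),(2,4,13),(3,3,23),
(2,5,23)}` (r1-2).  Degenerate members: `n = 0` never occurs (`p ≤ 1` is false); `p = kⁿ` only at `n = 1`,
`k` prime, where `LΨ_p = Σ_i z_{0,i}`. -/
theorem stub_boolSumWitness :
    GaussInversion → PhaseProduct → PsiLiftFormula →
      ∃ c : ℕ, ∀ (k : ℕ) [NeZero k] (p : ℕ) [Fact p.Prime] (n : ℕ), 2 ≤ k → p ≠ 2 → p ≤ k ^ n →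
        ∃ (r : ℕ) (g : MvPolynomial ((Fin n × Fin k) ⊕ Fin r) ℂ),
          boolSum g = fekDigit k p n ∧ r ≤ c * (k * n + 1) ^ c ∧
          complexity g ≤ c * (k * n + 1) ^ c ∧ g.totalDegree ≤ c * (k * n + 1) ^ c := by
  sorry

/-- **Stub T1 — univariate SOS from a digit circuit (L; shared with the sibling transfer lines).**
A uniform `c` such that for `k ≥ 2`, `n ≥ 1` and every `P ∈ ℂ[Fin n × Fin k]` with `complexity P ≤ s`,
`deg P ≤ n`: `ψ^{lin}(P) = Σ_{i<s'} aᵢ gᵢ²` with `s' ≤ (sn+2)^{c(⌊log₂ n⌋+1)}`,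
`deg gᵢ ≤ ⌈n/2⌉(k−1)k^{n−1}`, `|supp gᵢ| ≤ C(kn+⌈n/2⌉, ⌈n/2⌉)`.  Why true: rename `Fin n × Fin k ≃ Fin (n·k)`
(`finProdFinEquiv`; `complexity_renameEquiv_holds`, `totalDegree_rename`-invariance), apply the tree's PROVED
`DuttaSaxenaThierauf2024_sosDecomposition_holds` (`∃ c`; `(2:ℂ) ≠ 0`, `(3:ℂ) ≠ 0`): `P = Σ aᵢ qᵢ²`,
`s' ≤ (s·deg P+2)^{c(log(deg P)+1)} ≤ (sn+2)^{c(log n+1)}` (monotone in `deg P ≤ n`), `deg qᵢ ≤ (deg P+1)/2 ≤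
⌈n/2⌉`; push through the algebra hom `aeval (kron k n)` (squares ↦ squares); `gᵢ := aeval kron qᵢ` has
`natDegree ≤ deg qᵢ · max (i k^j) ≤ ⌈n/2⌉(k−1)k^{n−1}` and `|supp gᵢ| ≤ |supp qᵢ| ≤ #{monomials of degree
≤ ⌈n/2⌉ in kn variables} = C(kn+⌈n/2⌉, ⌈n/2⌉)` (`card_support_aeval_le_of_isTerm` with `isTerm_X_pow`;
`multichoose_eq_card_degreeMonomials` / `MvPolynomial.card_restrictTotalDegree`-type count).  Verbatim
`SketchIdeator3.univariateSOS_of_digitCircuit` with the triage fix `8 ↦ ∃ c`. -/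
theorem stub_univariateSOSTransfer :
    ∃ c : ℕ, ∀ (k n s : ℕ), 2 ≤ k → 1 ≤ n → ∀ P : MvPolynomial (Fin n × Fin k) ℂ,
      complexity P ≤ s → P.totalDegree ≤ n →
      ∃ (s' : ℕ) (a : Fin s' → ℂ) (g : Fin s' → Polynomial ℂ),
        s' ≤ (s * n + 2) ^ (c * (Nat.log 2 n + 1)) ∧
        (∀ i, (g i).natDegree ≤ ((n + 1) / 2) * (k - 1) * k ^ (n - 1)) ∧
        (∀ i, (g i).support.card ≤ (k * n + (n + 1) / 2).choose ((n + 1) / 2)) ∧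
        (∑ i, Polynomial.C (a i) * g i ^ 2) = MvPolynomial.aeval (kron k n) P := by
  sorry

/-- **Stub T2 — the counting inequalities (M/L; pure real analysis, SHARED verbatim with `gauss-phase-definability`).**
Why true: after `log`, (iii) reads `c(⌊log₂ n⌋+1)·log((nᵃ+a)n+2) + log C(kn+⌈n/2⌉,⌈n/2⌉) < (1/2+δ)·log p` with
`log p > n log k − log 2`; `log C(N, D) ≤ D(1 + log(N/D))` gives `log C(kn+⌈n/2⌉,⌈n/2⌉) ≤ ⌈n/2⌉(1 + log(2k+2))`,
so per unit `n` the claim is `½(1 + ln(2k+2)) < (½+δ) ln k`, i.e. `δ ln k > ½(1 + ln(2 + 2/k))` — true for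
`k ≥ k₀(δ)` (e.g. `ln k₀ ≥ 1.1/δ`), with the `O_{a,c}(log² n)` and `log 2` terms absorbed for `n ≥ n₀(δ,c,k,a)`;
(i) is `O(log² n) ≤ δ(n ln k − ln 2)`; (ii) is `n kⁿ ≤ k^{2n}/4 < p²` for `kⁿ ≥ 4n`.  Numerics (triage r1-1 T7,
r1-2, r1-3 J/J2; Disproof 5b): per-unit-`n` bits `3.85 < 5.21` (δ = 1/2, k = 37), `6.39 < 7.76` (δ = 1/4, k = 1297),
`14.15 < 15.51` (δ = 1/10, k = 6^{10}+1); onsets `n₀ = 1320/2334/3246` for `a = 1/2/3` at δ = 1/2.  Lean route: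
`Real.log_le_log_iff`/`Real.rpow_natCast`/`Real.log_rpow`, `Nat.choose_le_pow_div` + `Nat.factorial` lower bounds
(or `Nat.choose_le_pow`: `C(N,D) ≤ N^D` is too weak — use `C(N,D) ≤ (eN/D)^D` via `Real.add_one_le_exp`), and
`Real.isLittleO_log_rpow_atTop`/explicit `Real.log_le_sub_one_of_pos` bounds for `log² n = o(n)`.  The quantifier
order (`k₀` before `a`, `n₀` after) is what the plumbing `fekDigitNotVP_of` (PROVED below) consumes. -/
theorem stub_countingInequalities :
    ∀ (δ : ℝ), 0 < δ → δ ≤ 1 / 2 → ∀ c : ℕ, ∃ k₀ : ℕ, ∀ k : ℕ, k₀ ≤ k → ∀ a : ℕ, ∃ n₀ : ℕ,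
      ∀ n : ℕ, n₀ ≤ n → ∀ p : ℕ, k ^ n < 2 * p → p ≤ k ^ n →
        ((((n ^ a + a) * n + 2) ^ (c * (Nat.log 2 n + 1)) : ℕ) : ℝ) ≤ (p : ℝ) ^ δ ∧
        ((n + 1) / 2) * (k - 1) * k ^ (n - 1) ≤ p ^ 2 ∧
        ((((n ^ a + a) * n + 2) ^ (c * (Nat.log 2 n + 1)) *
            (k * n + (n + 1) / 2).choose ((n + 1) / 2) : ℕ) : ℝ) < (p : ℝ) ^ (1 / 2 + δ) := by
  sorry

/-! ## Proved facts (no `sorry`) -/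

/-- The digit lift has degree `≤ n` (a sum of products of `n` variables). -/
theorem totalDegree_fekDigit_le (k : ℕ) [NeZero k] (p : ℕ) [Fact p.Prime] (n : ℕ) :
    (fekDigit k p n).totalDegree ≤ n := by
  unfold fekDigit
  refine (totalDegree_finsetSum _ _).trans (Finset.sup_le fun m _ => ?_)
  refine (totalDegree_mul _ _).trans ?_
  rw [totalDegree_C, zero_add]
  refine (totalDegree_finsetProd _ _).trans ?_
  calc ∑ j : Fin n, (X (j, digit k m j) : MvPolynomial (Fin n × Fin k) ℂ).totalDegree
      ≤ ∑ _j : Fin n, 1 := Finset.sum_le_sum fun j _ => (totalDegree_X _).le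
    _ = n := by simp

/-- At `n = 0` the digit lift is a constant. -/
theorem fekDigit_zero (k : ℕ) [NeZero k] (p : ℕ) [Fact p.Prime] :
    fekDigit k p 0 = C (∑ m ∈ range p, ((legendreSym p m : ℤ) : ℂ)) := by
  unfold fekDigit
  rw [map_sum]
  refine Finset.sum_congr rfl fun m _ => ?_
  rw [Finset.univ_eq_empty, Finset.prod_empty, mul_one]

/-- The empty Boolean sum of `rename inl f` is `f` (the `u = 0` witness). -/
theorem boolSum_rename_inl {τ : Type} (f : MvPolynomial τ ℂ) :
    boolSum (m := 0) (rename Sum.inl f) = f := by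
  unfold boolSum
  have h : ∀ e : Fin 0 → Bool,
      aeval (Sum.elim X fun j => if e j then (1 : MvPolynomial τ ℂ) else 0) (rename Sum.inl f) = f := by
    intro e
    rw [aeval_rename]
    have hcomp : ((Sum.elim X fun j => if e j then (1 : MvPolynomial τ ℂ) else 0) ∘ Sum.inl) = X := by
      funext i; rfl
    rw [hcomp, aeval_X_left_apply]
  simp only [h, Finset.sum_const, Finset.card_univ]
  have hcard : Fintype.card (Fin 0 → Bool) = 1 := by simp
  rw [hcard, one_smul]

/-! ### T0 — faithfulness of the Kronecker lift (PROVED; was the card's smallest ingredient) -/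

@[simp] theorem digit_val (k : ℕ) [NeZero k] (m j : ℕ) : ((digit k m j : Fin k) : ℕ) = m / k ^ j % k := rfl

/-- Base-`k` expansion: `Σ_{j<n} digit_j(m)·k^j = m` for `m < kⁿ`. -/
theorem sum_digit_mul_pow (k : ℕ) [NeZero k] :
    ∀ (n m : ℕ), m < k ^ n → ∑ j : Fin n, ((digit k m j : Fin k) : ℕ) * k ^ (j : ℕ) = m := by
  intro n
  induction n with
  | zero =>
    intro m hm
    rw [pow_zero] at hm
    have hm0 : m = 0 := by omega
    subst hm0
    simp
  | succ n ih =>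
    intro m hm
    have hk : 0 < k := Nat.pos_of_neZero k
    rw [Fin.sum_univ_succ]
    simp only [digit_val, Fin.val_zero, pow_zero, Nat.div_one, mul_one, Fin.val_succ]
    have hm' : m / k < k ^ n := by
      rw [Nat.div_lt_iff_lt_mul hk]
      calc m < k ^ (n + 1) := hm
        _ = k ^ n * k := pow_succ k n
    have hterm : ∀ j : Fin n, m / k ^ ((j : ℕ) + 1) % k * k ^ ((j : ℕ) + 1)
        = k * ((m / k) / k ^ (j : ℕ) % k * k ^ (j : ℕ)) := by
      intro j
      rw [pow_succ', Nat.div_div_eq_div_mul]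
      ring
    simp only [hterm, ← Finset.mul_sum]
    have hih := ih (m / k) hm'
    simp only [digit_val] at hih
    rw [hih]
    exact Nat.mod_add_div m k

/-- **T0 (PROVED): `ψ^{lin}_{k,n}(Fek_{k,p,n}) = F_p` for `p ≤ kⁿ`** — `aeval` is an algebra hom, constants
go to constants, and `Π_j y_{j,digit_j m} ↦ X^{Σ_j digit_j(m) k^j} = X^m` for `m < p ≤ kⁿ`.  (The
hypothesis `2 ≤ k` of `KronFaithful` is not even needed.) -/
theorem kronFaithful : KronFaithful := by
  intro k _ p _ n hk hp
  unfold fekDigit feketePoly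
  rw [map_sum]
  refine Finset.sum_congr rfl fun m hm => ?_
  have hm' : m < k ^ n := lt_of_lt_of_le (Finset.mem_range.1 hm) hp
  rw [map_mul, MvPolynomial.aeval_C, map_prod, ← Polynomial.C_eq_algebraMap]
  congr 1
  simp only [MvPolynomial.aeval_X, kron]
  rw [Finset.prod_pow_eq_pow_sum, sum_digit_mul_pow k n m hm']

/-! ### V1 — Gauss inversion of the Legendre symbol (PROVED; the LEVER of the card) -/

open Literature.NumberTheory.GaussSums in
/-- **V1 (PROVED): for an odd prime `p`, `G_p ≠ 0` and `Σ_{x ∈ ℤ/p} e(m x²/p) = (m|p)·G_p + p·[p ∣ m]`.**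
Square counting `#{x : x² = y} = χ(y) + 1` (`quadraticChar_card_sqrts`), orthogonality
`Σ_y e(a y) = p·[a = 0]` (`AddChar.sum_mulShift`, `ZMod.isPrimitive_stdAddChar`), the twisted sum
`Σ_y χ(y) e(a y) = χ⁻¹(a) g(χ) = χ(a) g(χ)` (tree `sum_mulChar_mul_stdAddChar_mul`; `χ² = 1`), `G_p = g(χ)`
(the case `a = 1`), and `‖g(χ)‖² = p ≠ 0` (tree `norm_sq_gaussSum_stdAddChar`). -/
theorem gaussInversion : GaussInversion := by
  intro p hp hp2
  classical
  have hF : ringChar (ZMod p) ≠ 2 := by rwa [ZMod.ringChar_zmod_n]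
  set χ : MulChar (ZMod p) ℂ := (quadraticChar (ZMod p)).ringHomComp (Int.castRingHom ℂ) with hχ
  have hχ1 : χ ≠ 1 := quadraticChar_ringHomComp_ne_one hp2
  have hχinv : χ⁻¹ = χ := inv_eq_of_mul_eq_one_right quadraticChar_ringHomComp_mul_self
  -- (1) square counting: Σ_x e(a x²) = Σ_y (χ y + 1) e(a y)
  have hcount : ∀ a : ZMod p, (∑ x : ZMod p, (ZMod.stdAddChar (a * x ^ 2) : ℂ)) =
      ∑ y : ZMod p, (χ y + 1) * ZMod.stdAddChar (a * y) := by
    intro a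
    calc (∑ x : ZMod p, (ZMod.stdAddChar (a * x ^ 2) : ℂ))
        = ∑ y : ZMod p, ∑ x ∈ Finset.univ.filter (fun x : ZMod p => x ^ 2 = y),
            (ZMod.stdAddChar (a * x ^ 2) : ℂ) :=
          (Finset.sum_fiberwise Finset.univ (fun x : ZMod p => x ^ 2)
            (fun x => (ZMod.stdAddChar (a * x ^ 2) : ℂ))).symm
      _ = ∑ y : ZMod p, (χ y + 1) * ZMod.stdAddChar (a * y) := by
          refine Finset.sum_congr rfl fun y _ => ?_
          have hinner : (∑ x ∈ Finset.univ.filter (fun x : ZMod p => x ^ 2 = y),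
              (ZMod.stdAddChar (a * x ^ 2) : ℂ)) =
              ∑ x ∈ Finset.univ.filter (fun x : ZMod p => x ^ 2 = y), (ZMod.stdAddChar (a * y) : ℂ) := by
            refine Finset.sum_congr rfl fun x hx => ?_
            rw [(Finset.mem_filter.1 hx).2]
          rw [hinner, Finset.sum_const, nsmul_eq_mul]
          congr 1
          have hset : (Finset.univ.filter fun x : ZMod p => x ^ 2 = y) = {x : ZMod p | x ^ 2 = y}.toFinset := by
            ext x
            simp
          rw [hset]
          have hc := congrArg (fun z : ℤ => (z : ℂ)) (quadraticChar_card_sqrts hF y)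
          push_cast at hc
          rw [hc, hχ, quadraticChar_ringHomComp_apply]
  -- (2) orthogonality: Σ_y e(a y) = p [a = 0]
  have hflat : ∀ a : ZMod p, (∑ y : ZMod p, (ZMod.stdAddChar (a * y) : ℂ)) = if a = 0 then (p : ℂ) else 0 := by
    intro a
    have h := AddChar.sum_mulShift a (ZMod.isPrimitive_stdAddChar p)
    rw [ZMod.card] at h
    simp_rw [mul_comm _ a] at h
    rw [h, Nat.cast_ite, Nat.cast_zero]
  -- (3) twisted sum: Σ_y χ(y) e(a y) = χ(a) g(χ)
  have htw : ∀ a : ZMod p, (∑ y : ZMod p, χ y * ZMod.stdAddChar (a * y)) = χ a * gaussSum χ ZMod.stdAddChar := by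
    intro a
    have h := sum_mulChar_mul_stdAddChar_mul hχ1 a
    simp_rw [mul_comm _ a] at h
    rw [h, hχinv]
  -- (4) the two sums split
  have hsplit : ∀ a : ZMod p, (∑ x : ZMod p, (ZMod.stdAddChar (a * x ^ 2) : ℂ)) =
      χ a * gaussSum χ ZMod.stdAddChar + if a = 0 then (p : ℂ) else 0 := by
    intro a
    rw [hcount]
    simp_rw [add_mul, one_mul]
    rw [Finset.sum_add_distrib, htw, hflat]
  -- (5) G = g(χ)
  have hG : qGauss p = gaussSum χ ZMod.stdAddChar := by
    unfold qGauss
    have h1 := hsplit 1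
    simp only [one_mul, one_ne_zero, if_false, add_zero, MulChar.map_one] at h1
    exact h1
  -- (6) G ≠ 0
  have hGne : qGauss p ≠ 0 := by
    rw [hG]
    intro h0
    have hn := norm_sq_gaussSum_stdAddChar hχ1
    rw [h0, norm_zero] at hn
    have hp0 : (p : ℝ) ≠ 0 := Nat.cast_ne_zero.2 hp.out.ne_zero
    exact hp0 (by rw [← hn]; norm_num)
  refine ⟨hGne, fun m => ?_⟩
  rw [hsplit, ← hG]
  have hleg : χ (m : ZMod p) = ((legendreSym p m : ℤ) : ℂ) := by
    rw [hχ, quadraticChar_ringHomComp_apply]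
    simp [legendreSym]
  rw [hleg]
  by_cases hpm : p ∣ m
  · rw [if_pos hpm, if_pos ((ZMod.natCast_eq_zero_iff m p).2 hpm)]
  · rw [if_neg hpm, if_neg (mt (ZMod.natCast_eq_zero_iff m p).1 hpm)]

/-! ### V2 — the bit-phase product formula (PROVED; the second ingredient of the card) -/

/-- An additive character maps finite sums to finite products. -/
theorem addChar_map_sum {A M : Type*} [AddCommMonoid A] [CommMonoid M] (ψ : AddChar A M) {ι : Type*}
    (s : Finset ι) (f : ι → A) : ψ (∑ i ∈ s, f i) = ∏ i ∈ s, ψ (f i) := by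
  classical
  induction s using Finset.induction_on with
  | empty => simp
  | insert a s ha ih => rw [Finset.sum_insert ha, Finset.prod_insert ha, AddChar.map_add_eq_mul, ih]

/-- **V2 (PROVED): at a Boolean point the `r²`-factor product formula `phasePoly` evaluates to the root of
unity `e(c·v²/p)`, `v = Nat.ofBits e`.**  Each factor becomes `e(c·2^{a+b}·[e a]·[e b]/p)` (`[·] ∈ {0,1}`,
`e(0) = 1`), the character turns the double product into `e` of the double sum, and
`Σ_{a,b} c 2^{a+b} [e a][e b] = c·(Σ_a [e a] 2^a)² = c·v²` in `ZMod p`. -/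
theorem phaseProduct : PhaseProduct := by
  intro p _ c τ r e
  classical
  -- value of a Boolean variable under the `boolSum` substitution
  have hE : ∀ a : Fin r,
      MvPolynomial.aeval (Sum.elim MvPolynomial.X (fun a => if e a then (1 : MvPolynomial τ ℂ) else 0))
        (X (Sum.inr a) : MvPolynomial (τ ⊕ Fin r) ℂ) = C (((e a).toNat : ℕ) : ℂ) := by
    intro a
    rw [MvPolynomial.aeval_X, Sum.elim_inr]
    cases e a <;> simp
  -- each factor
  have hfac : ∀ a b : Fin r,
      MvPolynomial.aeval (Sum.elim MvPolynomial.X (fun a => if e a then (1 : MvPolynomial τ ℂ) else 0))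
        ((1 : MvPolynomial (τ ⊕ Fin r) ℂ) +
          C ((ZMod.stdAddChar (c * 2 ^ ((a : ℕ) + (b : ℕ))) : ℂ) - 1) * X (Sum.inr a) * X (Sum.inr b))
        = C ((ZMod.stdAddChar (c * 2 ^ ((a : ℕ) + (b : ℕ)) * (((e a).toNat : ℕ) : ZMod p) *
            (((e b).toNat : ℕ) : ZMod p))) : ℂ) := by
    intro a b
    rw [map_add, map_one, map_mul, map_mul, MvPolynomial.aeval_C, MvPolynomial.algebraMap_eq, hE, hE]
    cases e a <;> cases e b <;> simp [map_sub]
  -- the double product, factor by factor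
  have hprod : MvPolynomial.aeval (Sum.elim MvPolynomial.X (fun a => if e a then (1 : MvPolynomial τ ℂ) else 0))
        (phasePoly τ p c r)
      = C (∏ a : Fin r, ∏ b : Fin r, (ZMod.stdAddChar (c * 2 ^ ((a : ℕ) + (b : ℕ)) *
          (((e a).toNat : ℕ) : ZMod p) * (((e b).toNat : ℕ) : ZMod p)) : ℂ)) := by
    unfold phasePoly
    rw [map_prod, map_prod]
    refine Finset.prod_congr rfl fun a _ => ?_
    rw [map_prod, map_prod]
    exact Finset.prod_congr rfl fun b _ => hfac a b
  rw [hprod]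
  congr 1
  -- the character: product of values = value of the sum
  have hv : ((Nat.ofBits e : ℕ) : ZMod p) = ∑ t : Fin r, (((e t).toNat : ℕ) : ZMod p) * 2 ^ (t : ℕ) := by
    rw [BoolGadgets.ofBits_eq_sum]
    push_cast
    rfl
  have hsum : (∑ a : Fin r, ∑ b : Fin r, c * 2 ^ ((a : ℕ) + (b : ℕ)) * (((e a).toNat : ℕ) : ZMod p) *
      (((e b).toNat : ℕ) : ZMod p)) = c * ((Nat.ofBits e : ℕ) : ZMod p) ^ 2 := by
    rw [hv, sq, Finset.sum_mul_sum, Finset.mul_sum]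
    refine Finset.sum_congr rfl fun a _ => ?_
    rw [Finset.mul_sum]
    refine Finset.sum_congr rfl fun b _ => ?_
    rw [pow_add]
    ring
  rw [← hsum, addChar_map_sum]
  refine Finset.prod_congr rfl fun a _ => ?_
  rw [addChar_map_sum]

/-- The uniform bound `n ↦ c·(k n + 1)^c` is p-bounded (fixed `k`, `c`). -/
theorem isPBounded_bound (k c : ℕ) : IsPBounded fun n => c * (k * n + 1) ^ c := by
  refine (IsPBounded.iff_exists_le_mul_succ_pow _).2 ⟨c * (k + 1) ^ c, c, fun n => ?_⟩
  have h : k * n + 1 ≤ (k + 1) * (n + 1) := by nlinarith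
  calc c * (k * n + 1) ^ c ≤ c * ((k + 1) * (n + 1)) ^ c := by gcongr
    _ = c * (k + 1) ^ c * (n + 1) ^ c := by rw [mul_pow, mul_assoc]

/-- **V from V3 (PROVED glue): a Boolean-sum witness with uniform polynomial bounds makes the digit lift a
`VNP` family.**  Per `n ≥ 1` take the witness of `BoolSumWitness` (hypotheses `p_n ≠ 2`, `p_n ≤ kⁿ`); at
`n = 0` take `u = 0`, `g = rename inl Fek₀` (a constant).  p-boundedness: `#vars = kn + u n`,
`deg`, `complexity ≤ c(kn+1)^c` (`isPBounded_bound`, `IsPBounded.add_holds`/`mono`); `deg Fek_n ≤ n`. -/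
theorem fekDigitVNP_of_boolSumWitness (hW : BoolSumWitness) : FekDigitVNP := by
  intro k _ hk pSel hprime hodd hle
  obtain ⟨c, hc⟩ := hW
  -- a witness with bounds at EVERY level `n`
  have hex : ∀ n : ℕ, ∃ (r : ℕ) (g : MvPolynomial ((Fin n × Fin k) ⊕ Fin r) ℂ),
      boolSum g = fekDigit k (pSel n) n ∧ r ≤ c * (k * n + 1) ^ c ∧
      complexity g ≤ c * (k * n + 1) ^ c ∧ g.totalDegree ≤ c * (k * n + 1) ^ c := by
    intro n
    rcases Nat.eq_zero_or_pos n with rfl | hn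
    · refine ⟨0, rename Sum.inl (fekDigit k (pSel 0) 0), boolSum_rename_inl _, Nat.zero_le _, ?_, ?_⟩
      · rw [fekDigit_zero, rename_C, complexity_C_holds]
        exact Nat.zero_le _
      · rw [fekDigit_zero, rename_C, totalDegree_C]
        exact Nat.zero_le _
    · exact hc k (pSel n) n hk (hodd n) (hle n hn)
  choose u g hsum hu hcx hdeg using hex
  refine ⟨⟨?_, ?_⟩, u, g, ⟨⟨?_, ?_⟩, ?_⟩, fun n => (hsum n).symm⟩
  · -- number of variables `k·n` is p-bounded
    refine (IsPBounded.iff_exists_le_mul_succ_pow _).2 ⟨k, 1, fun n => ?_⟩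
    rw [Fintype.card_prod, Fintype.card_fin, Fintype.card_fin, pow_one]
    nlinarith
  · -- degree of the digit lift `≤ n`
    exact IsPBounded.mono IsPBounded.id fun n => totalDegree_fekDigit_le k (pSel n) n
  · -- number of variables of the witness `k·n + u n`
    have h1 : IsPBounded fun n => k * n + c * (k * n + 1) ^ c := by
      refine IsPBounded.add_holds ?_ (isPBounded_bound k c)
      refine (IsPBounded.iff_exists_le_mul_succ_pow _).2 ⟨k, 1, fun n => ?_⟩
      rw [pow_one]; nlinarith
    refine IsPBounded.mono h1 fun n => ?_
    rw [Fintype.card_sum, Fintype.card_prod, Fintype.card_fin, Fintype.card_fin, Fintype.card_fin]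
    have := hu n
    nlinarith
  · -- degree of the witness
    exact IsPBounded.mono (isPBounded_bound k c) fun n => hdeg n
  · -- complexity of the witness
    exact IsPBounded.mono (isPBounded_bound k c) fun n => hcx n

/-! ### T — the transfer plumbing (PROVED): T1 + T0 + the counting inequalities turn X into `FekDigitNotVP` -/

/-- **T plumbing (PROVED).**  From X take `δ ∈ (0, 1/2]` (landed `Negative.exists_delta_le_half_of_feketeSOSHard`)
and `p₀`; from T1 its constant `c`; `k₀` from the inequalities (and `≥ 2`).  For `k ≥ k₀`, a Bertrand selector
and a putative `VP` bound `complexity Fek_n ≤ nᵃ + a`, pick `n ≥ max n₀ 1 p₀`: T1 + T0 give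
`F_{p_n} = Σ_{i<s'} aᵢ gᵢ²` with the three bounds, `p_n > kⁿ/2 ≥ 2^{n−1} ≥ n ≥ p₀`, and X at `p = p_n` yields
`p_n^{1/2+δ} ≤ Σ|supp gᵢ| ≤ s'·C(kn+⌈n/2⌉,⌈n/2⌉) < p_n^{1/2+δ}`. -/
theorem fekDigitNotVP_of (hT1 : UnivariateSOSTransfer) (hT0 : KronFaithful) (hCI : CountingInequalities)
    (hX : FeketeSOS.FeketeSOSHard) : FekDigitNotVP := by
  classical
  obtain ⟨δ, hδ, hδ2, p₀, hXδ⟩ :=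
    Summit.ValiantsHypothesis.ValiantsHypothesis.Theorems.SOSMagnification.Negative.exists_delta_le_half_of_feketeSOSHard
      hX
  obtain ⟨c, hc⟩ := hT1
  obtain ⟨k₀, hk₀⟩ := hCI δ hδ hδ2 c
  refine ⟨max k₀ 2, ?_⟩
  intro k _ hk pSel _ hple hpbig hVP
  have hk2 : 2 ≤ k := le_trans (le_max_right _ _) hk
  have hk0 : k₀ ≤ k := le_trans (le_max_left _ _) hk
  obtain ⟨a, ha⟩ := hVP.2
  obtain ⟨n₀, hn₀⟩ := hk₀ k hk0 a
  -- a large level `n`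
  obtain ⟨n, hnn₀, hn1, hnp₀⟩ : ∃ n : ℕ, n₀ ≤ n ∧ 1 ≤ n ∧ p₀ ≤ n :=
    ⟨max n₀ (max 1 p₀), le_max_left _ _, le_trans (le_max_left _ _) (le_max_right _ _),
      le_trans (le_max_right _ _) (le_max_right _ _)⟩
  have hpk : pSel n ≤ k ^ n := hple n hn1
  have hkp : k ^ n < 2 * pSel n := hpbig n hn1
  obtain ⟨h1, h2, h3⟩ := hn₀ n hnn₀ (pSel n) hkp hpk
  -- `p₀ ≤ p_n`
  have hp₀p : p₀ ≤ pSel n := by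
    have h2n : ∀ m : ℕ, 2 * (m + 1) ≤ 2 ^ (m + 1) := by
      intro m
      induction m with
      | zero => norm_num
      | succ m ih => rw [pow_succ]; omega
    have h2n' : 2 * n ≤ 2 ^ n := by
      have := h2n (n - 1)
      rwa [Nat.sub_add_cancel hn1] at this
    have hk2n : 2 ^ n ≤ k ^ n := Nat.pow_le_pow_left hk2 n
    omega
  -- T1 at level `n`, then T0
  obtain ⟨s', a', g, hs', hdeg, hsupp, hrep⟩ :=
    hc k n (n ^ a + a) hk2 hn1 (fekDigit k (pSel n) n) (ha n) (totalDegree_fekDigit_le k (pSel n) n)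
  rw [hT0 k (pSel n) n hk2 hpk] at hrep
  -- X at `p = p_n`
  have hs'real : (s' : ℝ) ≤ (pSel n : ℝ) ^ δ := le_trans (by exact_mod_cast hs') h1
  have hdeg' : ∀ i, (g i).natDegree ≤ pSel n ^ 2 := fun i => (hdeg i).trans h2
  have key := hXδ (pSel n) hp₀p s' a' g hs'real hdeg' hrep
  -- support-sum ≤ s' · C(kn+⌈n/2⌉, ⌈n/2⌉) ≤ bound · C < p^{1/2+δ}
  have hsumNat : ∑ i, (g i).support.card ≤ s' * (k * n + (n + 1) / 2).choose ((n + 1) / 2) := by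
    calc ∑ i, (g i).support.card ≤ ∑ _i : Fin s', (k * n + (n + 1) / 2).choose ((n + 1) / 2) :=
          Finset.sum_le_sum fun i _ => hsupp i
      _ = s' * (k * n + (n + 1) / 2).choose ((n + 1) / 2) := by
          rw [Finset.sum_const, Finset.card_univ, Fintype.card_fin, smul_eq_mul]
  have hsum : (∑ i, ((g i).support.card : ℝ)) ≤
      ((s' * (k * n + (n + 1) / 2).choose ((n + 1) / 2) : ℕ) : ℝ) := by
    have h := hsumNat
    push_cast [← Nat.cast_sum] at h ⊢
    exact_mod_cast hsumNat
  have hbound : ((s' * (k * n + (n + 1) / 2).choose ((n + 1) / 2) : ℕ) : ℝ) ≤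
      ((((n ^ a + a) * n + 2) ^ (c * (Nat.log 2 n + 1)) *
        (k * n + (n + 1) / 2).choose ((n + 1) / 2) : ℕ) : ℝ) := by
    exact_mod_cast Nat.mul_le_mul_right _ hs'
  linarith

/-! ## The composition (kernel-checked, no `sorry` of its own) -/

/-- **The family cut.**  If the digit lift is p-definable for every radix `k ≥ 2` and every selector of
odd primes `p_n ≤ kⁿ`, and NOT p-computable for some `k₀`, all `k ≥ k₀` and all Bertrand selectors
`kⁿ/2 < p_n ≤ kⁿ`, then `VP_ℂ ≠ VNP_ℂ`.  (Adapted from ideator 3's checked composition: assume `VP_ℂ = VNP_ℂ`,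
pick `k := max k₀ 4` and a Bertrand selector of odd primes, `p_0 := 3`; bundle the digit family with
`PolyFamily.ofFintype` / `mem_VNP_ofFintype_iff_holds` / `mem_VP_ofFintype_iff_holds`.) -/
theorem valiantsHypothesis_of_vnp_of_notVP (hVNP : FekDigitVNP) (hLow : FekDigitNotVP) :
    _root_.ValiantsHypothesis := by
  show Literature.Computability.AlgebraicComplexity.VP ℂ ≠ Literature.Computability.AlgebraicComplexity.VNP ℂ
  intro hEq
  obtain ⟨k₀, hk₀⟩ := hLow
  obtain ⟨k, hk0, hk4⟩ : ∃ k : ℕ, k₀ ≤ k ∧ 4 ≤ k := ⟨max k₀ 4, le_max_left _ _, le_max_right _ _⟩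
  haveI : NeZero k := ⟨by omega⟩
  -- an odd prime selector with `kⁿ/2 < p_n ≤ kⁿ` for `n ≥ 1` (Bertrand), `p_0 := 3`
  have hsel : ∀ n : ℕ, ∃ p : ℕ, p.Prime ∧ p ≠ 2 ∧ (1 ≤ n → p ≤ k ^ n) ∧ (1 ≤ n → k ^ n < 2 * p) := by
    intro n
    rcases Nat.eq_zero_or_pos n with rfl | hn
    · exact ⟨3, Nat.prime_three, by norm_num, fun h => absurd h (by norm_num),
        fun h => absurd h (by norm_num)⟩
    · have hkn : 4 ≤ k ^ n :=
        calc 4 ≤ k := hk4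
          _ = k ^ 1 := (pow_one k).symm
          _ ≤ k ^ n := Nat.pow_le_pow_right (by omega) hn
      obtain ⟨p, hp, hlt, hle⟩ := Nat.exists_prime_lt_and_le_two_mul (k ^ n / 2) (by omega)
      exact ⟨p, hp, by omega, fun _ => by omega, fun _ => by omega⟩
  choose pSel hpP hp2 hple hpbig using hsel
  haveI : ∀ n, Fact (pSel n).Prime := fun n => ⟨hpP n⟩
  have h1 : IsVNPFamily (k := ℂ) (σ := fun n => Fin n × Fin k) (fun n => fekDigit k (pSel n) n) :=
    hVNP k (by omega) pSel hp2 hple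
  have h2 := hk₀ k hk0 pSel hple hpbig
  apply h2
  have hmem : PolyFamily.ofFintype (fun n => fekDigit k (pSel n) n) ∈
      Literature.Computability.AlgebraicComplexity.VNP ℂ :=
    (mem_VNP_ofFintype_iff_holds (k := ℂ) (σ := fun n => Fin n × Fin k)
      (fun n => fekDigit k (pSel n) n)).2 h1
  rw [← hEq] at hmem
  exact (mem_VP_ofFintype_iff_holds (k := ℂ) (σ := fun n => Fin n × Fin k)
    (fun n => fekDigit k (pSel n) n)).1 hmem

/-- **`SOSMagnification` from the four registered stubs, BY NAME** (the card's lever V1, its bit gadget V2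
and the faithfulness T0 are PROVED above, not stubbed): V1 (`gaussInversion`), V2 (`phaseProduct`) and V3a
(`stub_psiLiftFormula`) feed V3b (`stub_boolSumWitness`), which gives `FekDigitVNP` through the proved glue; T1
(`stub_univariateSOSTransfer`), T0 (`kronFaithful`) and T2 (`stub_countingInequalities`) turn the
crux's hypothesis X into `FekDigitNotVP` through the proved plumbing `fekDigitNotVP_of`; the family cut
concludes. -/
theorem SOSMagnification_of : FeketeSOS.SOSMagnification := fun hX =>
  valiantsHypothesis_of_vnp_of_notVP
    (fekDigitVNP_of_boolSumWitness (stub_boolSumWitness gaussInversion phaseProduct stub_psiLiftFormula))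
    (fekDigitNotVP_of stub_univariateSOSTransfer kronFaithful stub_countingInequalities hX)

/-! ## Scratch checks: the landed `Negative/*` lemma and every `Leans on:` name exist as used -/

/-- Landed Negative (p73035): WLOG `δ ≤ 1/2` in X — used in `fekDigitNotVP_of`. -/
example := @Summit.ValiantsHypothesis.ValiantsHypothesis.Theorems.SOSMagnification.Negative.exists_delta_le_half_of_feketeSOSHard
/-- DST24 Lemma 3.1 is PROVED in the tree (T1's engine). -/
example : DuttaSaxenaThierauf2024_sosDecomposition := DuttaSaxenaThierauf2024_sosDecomposition_holds
example := @card_support_aeval_le_of_isTerm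
example := @complexity_aeval_le
example := @complexity_finset_sum_le
example := @complexity_finset_prod_le
example := @complexity_renameEquiv_holds
example := @BoolGadgets.aeval_selProd
example := @BoolGadgets.ofBits_injective
example := @Literature.NumberTheory.GaussSums.sum_mulChar_mul_stdAddChar_mul
example := @Literature.NumberTheory.GaussSums.norm_sq_gaussSum_stdAddChar
example := @Literature.NumberTheory.GaussSums.quadraticChar_ringHomComp_apply
example := @quadraticChar_card_sqrts
example := @ZMod.isPrimitive_stdAddChar
example := @mem_VNP_ofFintype_iff_holds
example := @Nat.exists_prime_lt_and_le_two_mul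

end Summit.ValiantsHypothesis.ValiantsHypothesis.Cruxes.SOSMagnification.GaussSumFormulaWitness

end
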